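import Mathlib
import HarnessLib
import Literature.NumberTheory.DiophantineGeometry.BelyiDegreeBadPrimes
import Literature.NumberTheory.DiophantineGeometry.BelyiPairCentral

/-!
# Proof of the bad-prime floor `BadPrimeLeBelyiDegree` (Beckmann 1989 / Zapponi 2009)

This file discharges the named fact
`Literature.NumberTheory.DiophantineGeometry.BadPrimeLeBelyiDegree` of `BelyiDegreeBadPrimes.lean`:
for a rational fourth point `t` and a Belyi witness of degree `d` on `(ℙ¹; 0, 1, ∞, t)`, every prime
`ℓ` with `v_ℓ(t) ≠ 0` or `v_ℓ(1 - t) ≠ 0` satisfies `ℓ ≤ d`.  Printed sources: S. Beckmann,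
J. Algebra 125 (1989), Prop. 5.3 / Thm. 5.5 / Cor. 5.7 (good reduction of tame three-point covers at
`p ∤ |G|`); L. Zapponi, arXiv:0904.0967, Thm. 1.3 and Introduction.  Those proofs are
scheme-theoretic (purity of the branch locus, Abhyankar's lemma, stable models).  The proof here is
the elementary non-archimedean one in the spirit of U. Zannier, *Good reduction of certain covers
`ℙ¹ → ℙ¹`*, Israel J. Math. 124 (2001), Thm. 1, carried out over a place `A` of `ℂ` above `ℓ`
(`Literature.RingTheory.Valuation.AlgClosedResidue`):

1. `ℓ > d` makes the pair tame; the Gauss point of the unit disc is a cluster point (`0, 1` special)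
   hence central (`IsBelyiPair.central_of_isClusterPair`);
2. no special point lies outside the unit disc and no two special points share a residue class —
   otherwise the next cluster point up (resp. down) would be central too, contradicting
   `IsBelyiPair.not_central_below`;
3. hence all special points are `ℓ`-adic units with unit differences; for `t ∈ ℚ` this contradicts
   `v_ℓ(t) ≠ 0 ∨ v_ℓ(1 - t) ≠ 0`.

No statement of `BelyiDegreeBadPrimes.lean` is changed; this file only adds proofs.
-/

noncomputable section

namespace Literature.NumberTheory.DiophantineGeometry

open Polynomial IsLocalRing Literature.RingTheory.Valuation
open scoped Classical

section Equidistant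

variable {K : Type*} [Field K] [IsAlgClosed K] [CharZero K] (A : ValuationSubring K)
variable {d : ℕ} {p q : K[X]}

omit [IsAlgClosed K] [CharZero K] in
/-- Composition of two affine substitutions. [folklore] -/
theorem comp_affine_comp (f : K[X]) (s c s' c' : K) :
    (f.comp (C s + C c * X)).comp (C s' + C c' * X) = f.comp (C (s + c * s') + C (c * c') * X) := by
  rw [comp_assoc]
  congr 1
  simp only [add_comp, mul_comp, C_comp, X_comp, map_add, map_mul]
  ring

omit [IsAlgClosed K] [CharZero K] in
/-- A Belyi pair, normalised so that `0, 1` are special, is a cluster pair at the unit disc.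
[folklore] -/
theorem isClusterPair_of_zero_one {p q : K[X]} (h0 : (0 : K) ∈ (p * q * (p - q)).roots)
    (h1 : (1 : K) ∈ (p * q * (p - q)).roots) : IsClusterPair A p q := by
  refine ⟨0, h0, 1, h1, A.zero_mem, A.one_mem, ?_⟩
  intro heq
  have e0 : residue A (⟨0, A.zero_mem⟩ : A) = 0 := map_zero _
  have e1 : residue A (⟨1, A.one_mem⟩ : A) = 1 := map_one _
  rw [e0, e1] at heq
  exact zero_ne_one heq

/-- **All special points are integral.**  For a tame Belyi pair through `0` and `1`, every special
point lies in the closed unit disc. [folklore] -/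
theorem IsBelyiPair.mem_of_mem_roots (h : IsBelyiPair d p q)
    (htame : ∀ n : ℕ, 0 < n → n ≤ d → (n : ResidueField A) ≠ 0)
    (h0 : (0 : K) ∈ (p * q * (p - q)).roots) (h1 : (1 : K) ∈ (p * q * (p - q)).roots)
    {s : K} (hs : s ∈ (p * q * (p - q)).roots) : s ∈ A := by
  by_contra hsA
  have hcen := h.central_of_isClusterPair A htame (isClusterPair_of_zero_one A h0 h1)
  have hs1 : 1 < A.valuation s := by
    rw [← not_le, A.valuation_le_one_iff]; exact hsA
  -- the nearest special point outside the unit disc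
  set Sout := ((p * q * (p - q)).roots.toFinset.filter fun x => 1 < A.valuation x) with hSout
  obtain ⟨s₁, hs₁, hs₁min⟩ := Finset.exists_min_image Sout (fun x => A.valuation x)
    ⟨s, Finset.mem_filter.mpr ⟨Multiset.mem_toFinset.mpr hs, hs1⟩⟩
  rw [Finset.mem_filter, Multiset.mem_toFinset] at hs₁
  obtain ⟨hs₁F, hs₁gt⟩ := hs₁
  have hs₁0 : s₁ ≠ 0 := by
    intro h0'; rw [h0', map_zero] at hs₁gt; exact (not_lt.mpr zero_le) hs₁gt
  have hmin : ∀ x ∈ (p * q * (p - q)).roots, 1 < A.valuation x → A.valuation s₁ ≤ A.valuation x :=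
    fun x hx hx1 => hs₁min x (Finset.mem_filter.mpr ⟨Multiset.mem_toFinset.mpr hx, hx1⟩)
  -- the upper cluster pair on `D(0, v s₁)` is central
  set L : K[X] := C 0 + C s₁ * X with hL
  have h' : IsBelyiPair d (p.comp L) (q.comp L) := h.comp 0 hs₁0
  have h0' : (0 : K) ∈ (p.comp L * q.comp L * (p.comp L - q.comp L)).roots :=
    zero_mem_roots_prod_comp h0 hs₁0
  have h1' : (1 : K) ∈ (p.comp L * q.comp L * (p.comp L - q.comp L)).roots :=
    one_mem_roots_prod_comp (by rw [zero_add]; exact hs₁F) hs₁0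
  have hcen' := h'.central_of_isClusterPair A htame (isClusterPair_of_zero_one A h0' h1')
  -- below it, at radius `v s₁⁻¹`, sits the unit disc, also central: contradiction
  have hinv1 : A.valuation s₁⁻¹ < 1 := by rw [map_inv₀]; exact inv_lt_one_of_one_lt₀ hs₁gt
  refine h'.not_central_below A htame hcen' h0' A.zero_mem (inv_ne_zero hs₁0) hinv1 ?_ ?_
  · -- special points of the upper pair near `0` are within `v s₁⁻¹`
    intro σ hσ hσ1
    rw [hL, roots_prod_comp p q 0 hs₁0] at hσ
    obtain ⟨x, hx, rfl⟩ := Multiset.mem_map.mp hσ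
    rw [sub_zero] at hσ1 ⊢
    rw [sub_zero, map_mul, map_inv₀] at hσ1 ⊢
    have hvs₁ : 0 < A.valuation s₁ := lt_trans zero_lt_one hs₁gt
    rw [inv_mul_lt_iff₀ hvs₁, mul_one] at hσ1
    have hx1 : A.valuation x ≤ 1 := by
      by_contra hgt
      exact (not_le.mpr hσ1) (hmin x hx (not_le.mp hgt))
    calc (A.valuation s₁)⁻¹ * A.valuation x ≤ (A.valuation s₁)⁻¹ * 1 := mul_le_mul' le_rfl hx1
      _ = (A.valuation s₁)⁻¹ := mul_one _
  · rw [hL, comp_affine_comp, comp_affine_comp, ← sub_comp, zero_add, mul_zero, mul_inv_cancel₀ hs₁0,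
      C_0, C_1, one_mul, zero_add, comp_X, comp_X, comp_X]
    exact hcen

/-- **All special points are equidistant**: for a tame Belyi pair through `0` and `1`, any two
distinct special points differ by a unit. [folklore] -/
theorem IsBelyiPair.valuation_sub_eq_one (h : IsBelyiPair d p q)
    (htame : ∀ n : ℕ, 0 < n → n ≤ d → (n : ResidueField A) ≠ 0)
    (h0 : (0 : K) ∈ (p * q * (p - q)).roots) (h1 : (1 : K) ∈ (p * q * (p - q)).roots)
    {s s' : K} (hs : s ∈ (p * q * (p - q)).roots) (hs' : s' ∈ (p * q * (p - q)).roots) (hne : s ≠ s') :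
    A.valuation (s - s') = 1 := by
  have hsA := h.mem_of_mem_roots A htame h0 h1 hs
  have hs'A := h.mem_of_mem_roots A htame h0 h1 hs'
  have hle : A.valuation (s - s') ≤ 1 := (A.valuation_le_one_iff _).mpr (A.toSubring.sub_mem hsA hs'A)
  refine le_antisymm hle (not_lt.mp fun hlt => ?_)
  have hcen := h.central_of_isClusterPair A htame (isClusterPair_of_zero_one A h0 h1)
  -- translate to `s`: the base pair, still central, with special point `0`
  set L : K[X] := C s + C 1 * X with hL
  have hb : IsBelyiPair d (p.comp L) (q.comp L) := h.comp s one_ne_zero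
  have hb0 : (0 : K) ∈ (p.comp L * q.comp L * (p.comp L - q.comp L)).roots :=
    zero_mem_roots_prod_comp hs one_ne_zero
  have hcenb : gaussVal A (p.comp L) = gaussVal A (q.comp L) ∧
      gaussVal A (p.comp L - q.comp L) = gaussVal A (q.comp L) := by
    rw [hL, ← sub_comp, gaussVal_comp_X_add_C A p hsA, gaussVal_comp_X_add_C A q hsA,
      gaussVal_comp_X_add_C A (p - q) hsA]
    exact hcen
  -- the class of `s`: farthest special point at distance `< 1`
  set Sv := ((p * q * (p - q)).roots.toFinset.filter fun x => A.valuation (x - s) < 1 ∧ x ≠ s) with hSv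
  have hs'lt : A.valuation (s' - s) < 1 := by rw [Valuation.map_sub_swap]; exact hlt
  obtain ⟨s₁, hs₁, hs₁max⟩ := Finset.exists_max_image Sv (fun x => A.valuation (x - s))
    ⟨s', Finset.mem_filter.mpr ⟨Multiset.mem_toFinset.mpr hs', hs'lt, hne.symm⟩⟩
  rw [Finset.mem_filter, Multiset.mem_toFinset] at hs₁
  obtain ⟨hs₁F, hs₁lt, hs₁ne⟩ := hs₁
  set c₁ : K := s₁ - s with hc₁
  have hc₁0 : c₁ ≠ 0 := _root_.sub_ne_zero.mpr hs₁ne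
  have hclass : ∀ x ∈ (p * q * (p - q)).roots, A.valuation (x - s) < 1 → A.valuation (x - s) ≤ A.valuation c₁ := by
    intro x hx hxlt
    by_cases hxs : x = s
    · rw [hxs, sub_self, map_zero]; exact zero_le
    · exact hs₁max x (Finset.mem_filter.mpr ⟨Multiset.mem_toFinset.mpr hx, hxlt, hxs⟩)
  -- the lower cluster pair on `D(s, v c₁)` is central
  set L₁ : K[X] := C s + C c₁ * X with hL₁
  have hlow : IsBelyiPair d (p.comp L₁) (q.comp L₁) := h.comp s hc₁0
  have hlow0 : (0 : K) ∈ (p.comp L₁ * q.comp L₁ * (p.comp L₁ - q.comp L₁)).roots :=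
    zero_mem_roots_prod_comp hs hc₁0
  have hlow1 : (1 : K) ∈ (p.comp L₁ * q.comp L₁ * (p.comp L₁ - q.comp L₁)).roots :=
    one_mem_roots_prod_comp (by rw [hc₁, add_sub_cancel]; exact hs₁F) hc₁0
  have hcenlow := hlow.central_of_isClusterPair A htame (isClusterPair_of_zero_one A hlow0 hlow1)
  -- contradiction with `not_central_below` applied to the base pair
  refine hb.not_central_below A htame hcenb hb0 A.zero_mem hc₁0 hs₁lt ?_ ?_
  · intro σ hσ hσ1
    rw [hL, roots_prod_comp p q s one_ne_zero] at hσ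
    obtain ⟨x, hx, rfl⟩ := Multiset.mem_map.mp hσ
    rw [inv_one, one_mul, sub_zero] at hσ1 ⊢
    exact hclass x hx hσ1
  · rw [hL]
    simp only [comp_affine_comp]
    rw [mul_zero, add_zero, one_mul]
    exact hcenlow

end Equidistant

/-! ### The rational fourth point -/

section Rational

/-- If `v_ℓ(x) ≠ 0` for a rational `x`, then `x` is not a unit at any place above `ℓ`. [folklore] -/
theorem valuation_ratCast_ne_one {K : Type*} [Field K] [CharZero K] {Γ₀ : Type*}
    [LinearOrderedCommGroupWithZero Γ₀] {v : Valuation K Γ₀} {ℓ : ℕ} (hℓ : ℓ.Prime) (hvp : v ℓ < 1)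
    (hvZ : ∀ m : ℤ, v m ≤ 1) {x : ℚ} (hx : padicValRat ℓ x ≠ 0) : v (x : K) ≠ 1 := by
  have hxe : (x : K) = (x.num : K) / (x.den : K) := by
    rw [← Rat.cast_intCast, ← Rat.cast_natCast, ← Rat.cast_div, Rat.num_div_den]
  have hden0 : (x.den : K) ≠ 0 := Nat.cast_ne_zero.mpr x.den_nz
  have hcop : x.num.natAbs.Coprime x.den := x.reduced
  rw [hxe, map_div₀]
  by_cases hnum : (ℓ : ℤ) ∣ x.num
  · -- `ℓ ∣ num`, so `ℓ ∤ den`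
    have hden : ¬ ℓ ∣ x.den := fun hd => by
      have hn : ℓ ∣ x.num.natAbs := Int.natCast_dvd.mp hnum
      have := Nat.dvd_gcd hn hd
      rw [hcop.gcd_eq_one] at this
      exact hℓ.one_lt.ne' (Nat.dvd_one.mp this)
    have hvden : v (x.den : K) = 1 := by
      have hc : IsCoprime (x.den : ℤ) ℓ :=
        Nat.isCoprime_iff_coprime.mpr (Nat.Coprime.symm ((Nat.Prime.coprime_iff_not_dvd hℓ).mpr hden))
      have := valuation_intCast_eq_one_of_isCoprime hvp hvZ hc
      simpa using this
    have hvnum : v (x.num : K) < 1 := valuation_intCast_lt_one_of_dvd hvp hvZ hnum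
    rw [hvden, div_one]
    exact hvnum.ne
  · by_cases hden : ℓ ∣ x.den
    · have hvnum : v (x.num : K) = 1 := by
        have hn : ¬ ℓ ∣ x.num.natAbs := fun hd => hnum (Int.natCast_dvd.mpr hd)
        have hc : IsCoprime x.num (ℓ : ℤ) := by
          rw [Int.isCoprime_iff_gcd_eq_one]
          show Nat.gcd x.num.natAbs (ℓ : ℤ).natAbs = 1
          rw [Int.natAbs_natCast]
          exact ((Nat.Prime.coprime_iff_not_dvd hℓ).mpr hn).symm
        exact valuation_intCast_eq_one_of_isCoprime hvp hvZ hc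
      have hvden : v (x.den : K) < 1 := by
        have := valuation_intCast_lt_one_of_dvd hvp hvZ (Int.natCast_dvd_natCast.mpr hden)
        simpa using this
      rw [hvnum, one_div]
      intro h1
      exact hvden.ne (inv_eq_one.mp h1)
    · exfalso
      apply hx
      rw [padicValRat, padicValInt.eq_zero_of_not_dvd hnum, padicValNat.eq_zero_of_not_dvd hden]
      simp

end Rational

/-- **The bad-prime floor for the Belyi degree** (Beckmann 1989, Prop. 5.3 / Thm. 5.5 / Cor. 5.7;
Zapponi 2009, Thm. 1.3): discharge of the named fact `BadPrimeLeBelyiDegree` — if `(ℙ¹; 0, 1, ∞, q)`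
with `q ∈ ℚ` carries a Belyi witness of degree `d`, every prime `ℓ` with `v_ℓ(q) ≠ 0` or
`v_ℓ(1 - q) ≠ 0` satisfies `ℓ ≤ d`.  Proof: elementary non-archimedean counting at a place of `ℂ`
above `ℓ` (Zannier's method), see the module docstring.
[cite: Beckmann1989, Prop 5.3, Thm 5.5, Cor 5.7] [cite: Zapponi2009BelyiDegree, Thm 1.3] -/
theorem BadPrimeLeBelyiDegree_holds : BadPrimeLeBelyiDegree := by
  intro t d hw ℓ hℓ hbad
  by_contra hlt
  rw [not_le] at hlt
  -- `t ≠ 0, 1`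
  have ht0 : t ≠ 0 := by
    rintro rfl
    simp [padicValRat.zero, padicValRat.one] at hbad
  have ht1 : t ≠ 1 := by
    rintro rfl
    simp [padicValRat.zero, padicValRat.one] at hbad
  -- a place of `ℂ` above `ℓ`, tame for `d < ℓ`
  obtain ⟨A, hℓA⟩ := exists_valuationSubring_natCast_mem_maximalIdeal (K := ℂ) hℓ
  haveI := Fact.mk hℓ
  haveI : CharP (ResidueField A) ℓ := charP_residueField A hℓA
  have htame : ∀ n : ℕ, 0 < n → n ≤ d → (n : ResidueField A) ≠ 0 := by
    intro n hn hnd h0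
    rw [CharP.cast_eq_zero_iff (ResidueField A) ℓ n] at h0
    exact Nat.not_dvd_of_pos_of_lt hn (by omega) h0
  -- the Belyi pair
  obtain ⟨p, q, hpair, h0, h1, ht⟩ := (hasBelyiWitness_iff_exists_isBelyiPair d (t : ℂ)).mp hw
  have hF0 := hpair.prod_ne_zero
  have h0' : (0 : ℂ) ∈ (p * q * (p - q)).roots := (mem_roots hF0).mpr h0
  have h1' : (1 : ℂ) ∈ (p * q * (p - q)).roots := (mem_roots hF0).mpr h1
  have ht' : ((t : ℂ)) ∈ (p * q * (p - q)).roots := (mem_roots hF0).mpr ht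
  -- `t` and `t - 1` are units at the place
  have hvt : A.valuation ((t : ℂ) - 0) = 1 :=
    hpair.valuation_sub_eq_one A htame h0' h1' ht' h0' (by exact_mod_cast ht0)
  have hvt1 : A.valuation ((t : ℂ) - 1) = 1 :=
    hpair.valuation_sub_eq_one A htame h0' h1' ht' h1' (by exact_mod_cast ht1)
  rw [sub_zero] at hvt
  -- … contradicting `v_ℓ(t) ≠ 0 ∨ v_ℓ(1 - t) ≠ 0`
  have hvp : A.valuation (ℓ : ℂ) < 1 := by
    have := (A.valuation_lt_one_iff _).mp hℓA
    simpa using this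
  have hvZ : ∀ m : ℤ, A.valuation (m : ℂ) ≤ 1 := fun m =>
    (A.valuation_le_one_iff _).mpr (intCast_mem A m)
  rcases hbad with hb | hb
  · exact valuation_ratCast_ne_one hℓ hvp hvZ hb hvt
  · refine valuation_ratCast_ne_one hℓ hvp hvZ hb ?_
    rw [Rat.cast_sub, Rat.cast_one, Valuation.map_sub_swap]
    exact hvt1

end Literature.NumberTheory.DiophantineGeometry

end
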